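import Summits.ValiantsHypothesis.ValiantsHypothesis.Theorems.LacunarySymmetroidMatrixDescartesCensusChamberTransport
import Summits.ValiantsHypothesis.ValiantsHypothesis.Theorems.LacunarySymmetroidMatrixDescartesCensusFanKit

/-!
# `MatrixDescartes` census — chamber 1589, orientation `s = +`: the MARGIN of the NFLOW v6 (domination leaf) certificate by order-only transport

HONEST FRAMING.  Object-search cell `pub-symmetroid`, door-A target `DoorA26 := PosRootLawAt 2 6 19`
(stmt-ValiantsHypothesis-19979; OPEN, typed, never asserted), crux `Theses.LacunarySymmetroid.MatrixDescartes`
(stmt-ValiantsHypothesis-18050).  Part 2 of the kernel replay of the val-sym-door-p2 «NFLOW v6 (domination leaf, piece 5)» certificate (kit j271158) for chamber 1589 of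
theory g6's table, orientation `s = +`: for EVERY exponent vector `d` of the chamber the weighted sum of logs of the positive difference forms
(the constant term left after the Abel step, written in forms by the `…marginA` blocks) is at least `(109/8) · log 2`, by 21 order moves
`v ≤ v' ⇒ log v ≤ log v'` and 22 AM–GM splits `v + v' ≤ v'' ⇒ log 2 + (log v + log v')/2 ≤ log v''`, every premise LINEAR in `d` and
closed by `linarith` from the 20 chamber inequalities; no interval arithmetic.  Exponent vectors only (no pencils).  Nothing here bears on any
other chamber, on `DoorA26` (OPEN), on the crux, or on `VP ≠ VNP`.

[folklore] Kernel replay of an exact certificate (generated); elementary.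
-/

-- `Summit.ValiantsHypothesis.ValiantsHypothesis.…` repeats a component by the D-0017 layout
-- (single-conjunct summit), which the `dupNamespace` linter flags; the name is mandated.
set_option linter.dupNamespace false

namespace Summit.ValiantsHypothesis.ValiantsHypothesis.Theorems.LacunarySymmetroidMatrixDescartes.Census

open Polynomial Finset
open scoped BigOperators Polynomial Matrix

set_option maxHeartbeats 16000000 in
set_option maxRecDepth 100000 in
/-- **Margin for chamber 1589, `s = +`** (form version): `(109/8)·log 2 ≤ Σ_t A_t Σ_{s≠t} log v_{t,s}(d)` on the whole chamber. [folklore] -/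
theorem chamber1589posp5d1_pos_marginB (σ : Fin 21 → Fin 6 × Fin 6)
    (hσ : σ = ![(0, 0), (0, 1), (0, 2), (1, 1), (1, 2), (2, 2), (0, 3), (0, 4), (1, 3), (0, 5), (1, 4),
        (2, 3), (2, 4), (1, 5), (2, 5), (3, 3), (3, 4), (4, 4), (3, 5), (4, 5), (5, 5)])
    (d : Fin 6 → ℕ) (hd : StrictMono ((fun p : Fin 6 × Fin 6 => d p.1 + d p.2) ∘ σ))
    (_hq0 : (((d 0 : ℝ) + (d 3 : ℝ)) - ((2 : ℝ) * (d 2 : ℝ))) ≤ (((d 1 : ℝ) + (d 5 : ℝ)) - ((d 2 : ℝ) + (d 4 : ℝ))))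
    (_hq1 : (((d 0 : ℝ) + (d 5 : ℝ)) - ((d 1 : ℝ) + (d 3 : ℝ))) ≤ (((d 1 : ℝ) + (d 5 : ℝ)) - ((d 2 : ℝ) + (d 4 : ℝ))))
    (_hq2 : (((d 2 : ℝ) + (d 3 : ℝ)) - ((d 1 : ℝ) + (d 4 : ℝ))) ≤ (((d 1 : ℝ) + (d 5 : ℝ)) - ((d 2 : ℝ) + (d 4 : ℝ))))
    (_hq3 : (((d 1 : ℝ) + (d 4 : ℝ)) - ((d 0 : ℝ) + (d 5 : ℝ))) ≤ (((d 1 : ℝ) + (d 5 : ℝ)) - ((d 2 : ℝ) + (d 4 : ℝ)))) :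
    ((109 : ℝ) / 8) * Real.log 2 ≤
    (1 : ℝ) * (Real.log (((d 1 : ℝ) + (d 1 : ℝ)) - ((d 0 : ℝ) + (d 0 : ℝ))) + Real.log (((d 1 : ℝ)) - ((d 0 : ℝ))) + Real.log (((d 1 : ℝ) + (d 1 : ℝ)) - ((d 0 : ℝ) + (d 2 : ℝ))) + Real.log (((d 2 : ℝ)) - ((d 1 : ℝ))) +
      Real.log (((d 2 : ℝ) + (d 2 : ℝ)) - ((d 1 : ℝ) + (d 1 : ℝ))) + Real.log (((d 0 : ℝ) + (d 3 : ℝ)) - ((d 1 : ℝ) + (d 1 : ℝ))) + Real.log (((d 0 : ℝ) + (d 4 : ℝ)) - ((d 1 : ℝ) + (d 1 : ℝ))) + Real.log (((d 3 : ℝ)) - ((d 1 : ℝ))) +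
      Real.log (((d 0 : ℝ) + (d 5 : ℝ)) - ((d 1 : ℝ) + (d 1 : ℝ))) + Real.log (((d 4 : ℝ)) - ((d 1 : ℝ))) + Real.log (((d 2 : ℝ) + (d 3 : ℝ)) - ((d 1 : ℝ) + (d 1 : ℝ))) + Real.log (((d 2 : ℝ) + (d 4 : ℝ)) - ((d 1 : ℝ) + (d 1 : ℝ))) +
      Real.log (((d 5 : ℝ)) - ((d 1 : ℝ))) + Real.log (((d 2 : ℝ) + (d 5 : ℝ)) - ((d 1 : ℝ) + (d 1 : ℝ))) + Real.log (((d 3 : ℝ) + (d 3 : ℝ)) - ((d 1 : ℝ) + (d 1 : ℝ))) + Real.log (((d 3 : ℝ) + (d 4 : ℝ)) - ((d 1 : ℝ) + (d 1 : ℝ))) +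
      Real.log (((d 4 : ℝ) + (d 4 : ℝ)) - ((d 1 : ℝ) + (d 1 : ℝ))) + Real.log (((d 3 : ℝ) + (d 5 : ℝ)) - ((d 1 : ℝ) + (d 1 : ℝ))) + Real.log (((d 4 : ℝ) + (d 5 : ℝ)) - ((d 1 : ℝ) + (d 1 : ℝ))) + Real.log (((d 5 : ℝ) + (d 5 : ℝ)) - ((d 1 : ℝ) + (d 1 : ℝ)))) + (-2 : ℝ) * (Real.log (((d 1 : ℝ) + (d 4 : ℝ)) - ((d 0 : ℝ) + (d 0 : ℝ))) + Real.log (((d 4 : ℝ)) - ((d 0 : ℝ))) + Real.log (((d 1 : ℝ) + (d 4 : ℝ)) - ((d 0 : ℝ) + (d 2 : ℝ))) + Real.log (((d 4 : ℝ)) - ((d 1 : ℝ))) +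
      Real.log (((d 4 : ℝ)) - ((d 2 : ℝ))) + Real.log (((d 1 : ℝ) + (d 4 : ℝ)) - ((d 2 : ℝ) + (d 2 : ℝ))) + Real.log (((d 1 : ℝ) + (d 4 : ℝ)) - ((d 0 : ℝ) + (d 3 : ℝ))) + Real.log (((d 1 : ℝ)) - ((d 0 : ℝ))) +
      Real.log (((d 4 : ℝ)) - ((d 3 : ℝ))) + Real.log (((d 1 : ℝ) + (d 4 : ℝ)) - ((d 0 : ℝ) + (d 5 : ℝ))) + Real.log (((d 2 : ℝ) + (d 3 : ℝ)) - ((d 1 : ℝ) + (d 4 : ℝ))) + Real.log (((d 2 : ℝ)) - ((d 1 : ℝ))) +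
      Real.log (((d 5 : ℝ)) - ((d 4 : ℝ))) + Real.log (((d 2 : ℝ) + (d 5 : ℝ)) - ((d 1 : ℝ) + (d 4 : ℝ))) + Real.log (((d 3 : ℝ) + (d 3 : ℝ)) - ((d 1 : ℝ) + (d 4 : ℝ))) + Real.log (((d 3 : ℝ)) - ((d 1 : ℝ))) +
      Real.log (((d 4 : ℝ)) - ((d 1 : ℝ))) + Real.log (((d 3 : ℝ) + (d 5 : ℝ)) - ((d 1 : ℝ) + (d 4 : ℝ))) + Real.log (((d 5 : ℝ)) - ((d 1 : ℝ))) + Real.log (((d 5 : ℝ) + (d 5 : ℝ)) - ((d 1 : ℝ) + (d 4 : ℝ)))) + (1 : ℝ) * (Real.log (((d 4 : ℝ) + (d 4 : ℝ)) - ((d 0 : ℝ) + (d 0 : ℝ))) + Real.log (((d 4 : ℝ) + (d 4 : ℝ)) - ((d 0 : ℝ) + (d 1 : ℝ))) + Real.log (((d 4 : ℝ) + (d 4 : ℝ)) - ((d 0 : ℝ) + (d 2 : ℝ))) + Real.log (((d 4 : ℝ) + (d 4 : ℝ)) - ((d 1 : ℝ) + (d 1 : ℝ))) +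
      Real.log (((d 4 : ℝ) + (d 4 : ℝ)) - ((d 1 : ℝ) + (d 2 : ℝ))) + Real.log (((d 4 : ℝ) + (d 4 : ℝ)) - ((d 2 : ℝ) + (d 2 : ℝ))) + Real.log (((d 4 : ℝ) + (d 4 : ℝ)) - ((d 0 : ℝ) + (d 3 : ℝ))) + Real.log (((d 4 : ℝ)) - ((d 0 : ℝ))) +
      Real.log (((d 4 : ℝ) + (d 4 : ℝ)) - ((d 1 : ℝ) + (d 3 : ℝ))) + Real.log (((d 4 : ℝ) + (d 4 : ℝ)) - ((d 0 : ℝ) + (d 5 : ℝ))) + Real.log (((d 4 : ℝ)) - ((d 1 : ℝ))) + Real.log (((d 4 : ℝ) + (d 4 : ℝ)) - ((d 2 : ℝ) + (d 3 : ℝ))) +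
      Real.log (((d 4 : ℝ)) - ((d 2 : ℝ))) + Real.log (((d 4 : ℝ) + (d 4 : ℝ)) - ((d 1 : ℝ) + (d 5 : ℝ))) + Real.log (((d 4 : ℝ) + (d 4 : ℝ)) - ((d 2 : ℝ) + (d 5 : ℝ))) + Real.log (((d 4 : ℝ) + (d 4 : ℝ)) - ((d 3 : ℝ) + (d 3 : ℝ))) +
      Real.log (((d 4 : ℝ)) - ((d 3 : ℝ))) + Real.log (((d 3 : ℝ) + (d 5 : ℝ)) - ((d 4 : ℝ) + (d 4 : ℝ))) + Real.log (((d 5 : ℝ)) - ((d 4 : ℝ))) + Real.log (((d 5 : ℝ) + (d 5 : ℝ)) - ((d 4 : ℝ) + (d 4 : ℝ)))) := by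
  have hcov : ∀ p : Fin 6 × Fin 6, ∃ t : Fin 21, σ t = p ∨ σ t = p.swap := by rw [hσ]; decide
  have e0 : σ 0 = ((0 : Fin 6), (0 : Fin 6)) := by rw [hσ]; decide
  have e1 : σ 1 = ((0 : Fin 6), (1 : Fin 6)) := by rw [hσ]; decide
  have e2 : σ 2 = ((0 : Fin 6), (2 : Fin 6)) := by rw [hσ]; decide
  have e3 : σ 3 = ((1 : Fin 6), (1 : Fin 6)) := by rw [hσ]; decide
  have e4 : σ 4 = ((1 : Fin 6), (2 : Fin 6)) := by rw [hσ]; decide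
  have e5 : σ 5 = ((2 : Fin 6), (2 : Fin 6)) := by rw [hσ]; decide
  have e6 : σ 6 = ((0 : Fin 6), (3 : Fin 6)) := by rw [hσ]; decide
  have e7 : σ 7 = ((0 : Fin 6), (4 : Fin 6)) := by rw [hσ]; decide
  have e8 : σ 8 = ((1 : Fin 6), (3 : Fin 6)) := by rw [hσ]; decide
  have e9 : σ 9 = ((0 : Fin 6), (5 : Fin 6)) := by rw [hσ]; decide
  have e10 : σ 10 = ((1 : Fin 6), (4 : Fin 6)) := by rw [hσ]; decide
  have e11 : σ 11 = ((2 : Fin 6), (3 : Fin 6)) := by rw [hσ]; decide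
  have e12 : σ 12 = ((2 : Fin 6), (4 : Fin 6)) := by rw [hσ]; decide
  have e13 : σ 13 = ((1 : Fin 6), (5 : Fin 6)) := by rw [hσ]; decide
  have e14 : σ 14 = ((2 : Fin 6), (5 : Fin 6)) := by rw [hσ]; decide
  have e15 : σ 15 = ((3 : Fin 6), (3 : Fin 6)) := by rw [hσ]; decide
  have e16 : σ 16 = ((3 : Fin 6), (4 : Fin 6)) := by rw [hσ]; decide
  have e17 : σ 17 = ((4 : Fin 6), (4 : Fin 6)) := by rw [hσ]; decide
  have e18 : σ 18 = ((3 : Fin 6), (5 : Fin 6)) := by rw [hσ]; decide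
  have e19 : σ 19 = ((4 : Fin 6), (5 : Fin 6)) := by rw [hσ]; decide
  have e20 : σ 20 = ((5 : Fin 6), (5 : Fin 6)) := by rw [hσ]; decide
  have c0 : ((d 0 : ℝ) + (d 0 : ℝ)) < ((d 0 : ℝ) + (d 1 : ℝ)) := by have h := hd (show (0 : Fin 21) < 1 by decide); simp only [Function.comp, e0, e1] at h; exact_mod_cast h
  have c1 : ((d 0 : ℝ) + (d 1 : ℝ)) < ((d 0 : ℝ) + (d 2 : ℝ)) := by have h := hd (show (1 : Fin 21) < 2 by decide); simp only [Function.comp, e1, e2] at h; exact_mod_cast h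
  have c2 : ((d 0 : ℝ) + (d 2 : ℝ)) < ((d 1 : ℝ) + (d 1 : ℝ)) := by have h := hd (show (2 : Fin 21) < 3 by decide); simp only [Function.comp, e2, e3] at h; exact_mod_cast h
  have c3 : ((d 1 : ℝ) + (d 1 : ℝ)) < ((d 1 : ℝ) + (d 2 : ℝ)) := by have h := hd (show (3 : Fin 21) < 4 by decide); simp only [Function.comp, e3, e4] at h; exact_mod_cast h
  have c4 : ((d 1 : ℝ) + (d 2 : ℝ)) < ((d 2 : ℝ) + (d 2 : ℝ)) := by have h := hd (show (4 : Fin 21) < 5 by decide); simp only [Function.comp, e4, e5] at h; exact_mod_cast h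
  have c5 : ((d 2 : ℝ) + (d 2 : ℝ)) < ((d 0 : ℝ) + (d 3 : ℝ)) := by have h := hd (show (5 : Fin 21) < 6 by decide); simp only [Function.comp, e5, e6] at h; exact_mod_cast h
  have c6 : ((d 0 : ℝ) + (d 3 : ℝ)) < ((d 0 : ℝ) + (d 4 : ℝ)) := by have h := hd (show (6 : Fin 21) < 7 by decide); simp only [Function.comp, e6, e7] at h; exact_mod_cast h
  have c7 : ((d 0 : ℝ) + (d 4 : ℝ)) < ((d 1 : ℝ) + (d 3 : ℝ)) := by have h := hd (show (7 : Fin 21) < 8 by decide); simp only [Function.comp, e7, e8] at h; exact_mod_cast h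
  have c8 : ((d 1 : ℝ) + (d 3 : ℝ)) < ((d 0 : ℝ) + (d 5 : ℝ)) := by have h := hd (show (8 : Fin 21) < 9 by decide); simp only [Function.comp, e8, e9] at h; exact_mod_cast h
  have c9 : ((d 0 : ℝ) + (d 5 : ℝ)) < ((d 1 : ℝ) + (d 4 : ℝ)) := by have h := hd (show (9 : Fin 21) < 10 by decide); simp only [Function.comp, e9, e10] at h; exact_mod_cast h
  have c10 : ((d 1 : ℝ) + (d 4 : ℝ)) < ((d 2 : ℝ) + (d 3 : ℝ)) := by have h := hd (show (10 : Fin 21) < 11 by decide); simp only [Function.comp, e10, e11] at h; exact_mod_cast h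
  have c11 : ((d 2 : ℝ) + (d 3 : ℝ)) < ((d 2 : ℝ) + (d 4 : ℝ)) := by have h := hd (show (11 : Fin 21) < 12 by decide); simp only [Function.comp, e11, e12] at h; exact_mod_cast h
  have c12 : ((d 2 : ℝ) + (d 4 : ℝ)) < ((d 1 : ℝ) + (d 5 : ℝ)) := by have h := hd (show (12 : Fin 21) < 13 by decide); simp only [Function.comp, e12, e13] at h; exact_mod_cast h
  have c13 : ((d 1 : ℝ) + (d 5 : ℝ)) < ((d 2 : ℝ) + (d 5 : ℝ)) := by have h := hd (show (13 : Fin 21) < 14 by decide); simp only [Function.comp, e13, e14] at h; exact_mod_cast h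
  have c14 : ((d 2 : ℝ) + (d 5 : ℝ)) < ((d 3 : ℝ) + (d 3 : ℝ)) := by have h := hd (show (14 : Fin 21) < 15 by decide); simp only [Function.comp, e14, e15] at h; exact_mod_cast h
  have c15 : ((d 3 : ℝ) + (d 3 : ℝ)) < ((d 3 : ℝ) + (d 4 : ℝ)) := by have h := hd (show (15 : Fin 21) < 16 by decide); simp only [Function.comp, e15, e16] at h; exact_mod_cast h
  have c16 : ((d 3 : ℝ) + (d 4 : ℝ)) < ((d 4 : ℝ) + (d 4 : ℝ)) := by have h := hd (show (16 : Fin 21) < 17 by decide); simp only [Function.comp, e16, e17] at h; exact_mod_cast h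
  have c17 : ((d 4 : ℝ) + (d 4 : ℝ)) < ((d 3 : ℝ) + (d 5 : ℝ)) := by have h := hd (show (17 : Fin 21) < 18 by decide); simp only [Function.comp, e17, e18] at h; exact_mod_cast h
  have c18 : ((d 3 : ℝ) + (d 5 : ℝ)) < ((d 4 : ℝ) + (d 5 : ℝ)) := by have h := hd (show (18 : Fin 21) < 19 by decide); simp only [Function.comp, e18, e19] at h; exact_mod_cast h
  have c19 : ((d 4 : ℝ) + (d 5 : ℝ)) < ((d 5 : ℝ) + (d 5 : ℝ)) := by have h := hd (show (19 : Fin 21) < 20 by decide); simp only [Function.comp, e19, e20] at h; exact_mod_cast h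
  have tN0 : Real.log (((d 1 : ℝ) + (d 4 : ℝ)) - ((d 0 : ℝ) + (d 0 : ℝ))) ≤ Real.log (((d 4 : ℝ) + (d 4 : ℝ)) - ((d 0 : ℝ) + (d 1 : ℝ))) := Real.log_le_log (by linarith only [c0, c1, c6, c14, c19]) (by linarith only [c1, c6, c8, c14])
  have tN1 : Real.log (((d 1 : ℝ) + (d 4 : ℝ)) - ((d 0 : ℝ) + (d 0 : ℝ))) ≤ Real.log (((d 3 : ℝ) + (d 5 : ℝ)) - ((d 1 : ℝ) + (d 1 : ℝ))) := Real.log_le_log (by linarith only [c0, c1, c6, c14, c19]) (by linarith only [c8, c10, c14])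
  have tN2 : Real.log (((d 1 : ℝ) + (d 4 : ℝ)) - ((d 0 : ℝ) + (d 2 : ℝ))) ≤ Real.log (((d 4 : ℝ) + (d 4 : ℝ)) - ((d 1 : ℝ) + (d 2 : ℝ))) := Real.log_le_log (by linarith only [c0, c6, c14, c19]) (by linarith only [c1, c6, c8, c14])
  have tN3 : Real.log (((d 1 : ℝ) + (d 4 : ℝ)) - ((d 0 : ℝ) + (d 2 : ℝ))) ≤ Real.log (((d 4 : ℝ) + (d 4 : ℝ)) - ((d 2 : ℝ) + (d 2 : ℝ))) := Real.log_le_log (by linarith only [c0, c6, c14, c19]) (by linarith only [c6, c8, c14])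
  have tN4 : Real.log (((d 1 : ℝ) + (d 4 : ℝ)) - ((d 0 : ℝ) + (d 3 : ℝ))) ≤ Real.log (((d 2 : ℝ) + (d 4 : ℝ)) - ((d 1 : ℝ) + (d 1 : ℝ))) := Real.log_le_log (by linarith only [c0, c6]) (by linarith only [c1, c8, c14])
  have tN5 : Real.log (((d 5 : ℝ) + (d 5 : ℝ)) - ((d 1 : ℝ) + (d 4 : ℝ))) ≤ Real.log (((d 4 : ℝ) + (d 4 : ℝ)) - ((d 0 : ℝ) + (d 2 : ℝ))) := Real.log_le_log (by linarith only [c1, c6, c14, c19]) (by linarith only [c6, c9, c14])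
  have tN6 : Real.log (((d 5 : ℝ) + (d 5 : ℝ)) - ((d 1 : ℝ) + (d 4 : ℝ))) ≤ Real.log (((d 4 : ℝ) + (d 5 : ℝ)) - ((d 1 : ℝ) + (d 1 : ℝ))) := Real.log_le_log (by linarith only [c1, c6, c14, c19]) (by linarith only [c1, c6, c14])
  have tN7 : Real.log (((d 5 : ℝ)) - ((d 1 : ℝ))) ≤ Real.log (((d 2 : ℝ) + (d 5 : ℝ)) - ((d 1 : ℝ) + (d 1 : ℝ))) := Real.log_le_log (by linarith only [c1, c6, c14, c19]) (by linarith only [c1])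
  have tN8 : Real.log (((d 5 : ℝ)) - ((d 1 : ℝ))) ≤ Real.log (((d 4 : ℝ) + (d 5 : ℝ)) - ((d 1 : ℝ) + (d 3 : ℝ))) := Real.log_le_log (by linarith only [c1, c6, c14, c19]) (by linarith only [c6])
  have tN9 : Real.log (((d 3 : ℝ) + (d 5 : ℝ)) - ((d 1 : ℝ) + (d 4 : ℝ))) ≤ Real.log (((d 4 : ℝ) + (d 4 : ℝ)) - ((d 0 : ℝ) + (d 3 : ℝ))) := Real.log_le_log (by linarith only [c1, c6, c14, c19]) (by linarith only [c6, c9])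
  have tN10 : Real.log (((d 3 : ℝ) + (d 5 : ℝ)) - ((d 1 : ℝ) + (d 4 : ℝ))) ≤ Real.log (((d 2 : ℝ) + (d 5 : ℝ)) - ((d 1 : ℝ) + (d 1 : ℝ))) := Real.log_le_log (by linarith only [c1, c6, c14, c19]) (by linarith only [c1, c6])
  have tN11 : Real.log (((d 3 : ℝ)) - ((d 1 : ℝ))) ≤ Real.log (((d 2 : ℝ) + (d 3 : ℝ)) - ((d 1 : ℝ) + (d 1 : ℝ))) := Real.log_le_log (by linarith only [c1, c6, c14, c19]) (by linarith only [c1])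
  have tN12 : Real.log (((d 3 : ℝ) + (d 3 : ℝ)) - ((d 1 : ℝ) + (d 4 : ℝ))) ≤ Real.log (((d 4 : ℝ) + (d 4 : ℝ)) - ((d 1 : ℝ) + (d 3 : ℝ))) := Real.log_le_log (by linarith only [c1, c14, c19]) (by linarith only [c6])
  have tN13 : Real.log (((d 3 : ℝ) + (d 3 : ℝ)) - ((d 1 : ℝ) + (d 4 : ℝ))) ≤ Real.log (((d 0 : ℝ) + (d 5 : ℝ)) - ((d 1 : ℝ) + (d 1 : ℝ))) := Real.log_le_log (by linarith only [c1, c14, c19]) (by linarith only [c6, c8])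
  have tN14 : Real.log (((d 2 : ℝ) + (d 4 : ℝ)) - ((d 1 : ℝ) + (d 3 : ℝ))) ≤ Real.log (((d 0 : ℝ) + (d 4 : ℝ)) - ((d 1 : ℝ) + (d 2 : ℝ))) := Real.log_le_log (by linarith only [c1, c6]) (by linarith only [c5])
  have tN15 : Real.log (((d 2 : ℝ) + (d 5 : ℝ)) - ((d 1 : ℝ) + (d 4 : ℝ))) ≤ Real.log (((d 2 : ℝ) + (d 4 : ℝ)) - ((d 1 : ℝ) + (d 1 : ℝ))) := Real.log_le_log (by linarith only [c1, c19]) (by linarith only [c1, c6, c14])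
  have tN16 : Real.log (((d 2 : ℝ) + (d 5 : ℝ)) - ((d 1 : ℝ) + (d 4 : ℝ))) ≤ Real.log (((d 2 : ℝ) + (d 3 : ℝ)) - ((d 1 : ℝ) + (d 1 : ℝ))) := Real.log_le_log (by linarith only [c1, c19]) (by linarith only [c1, c6, c14])
  have tN17 : Real.log (((d 2 : ℝ) + (d 5 : ℝ)) - ((d 1 : ℝ) + (d 4 : ℝ))) ≤ Real.log (((d 2 : ℝ) + (d 5 : ℝ)) - ((d 1 : ℝ) + (d 3 : ℝ))) := Real.log_le_log (by linarith only [c1, c19]) (by linarith only [c6])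
  have tN18 : Real.log (((d 4 : ℝ)) - ((d 2 : ℝ))) ≤ Real.log (((d 4 : ℝ) + (d 4 : ℝ)) - ((d 2 : ℝ) + (d 3 : ℝ))) := Real.log_le_log (by linarith only [c6, c14, c19]) (by linarith only [c6])
  have tN19 : Real.log (((d 1 : ℝ) + (d 4 : ℝ)) - ((d 2 : ℝ) + (d 2 : ℝ))) ≤ Real.log (((d 4 : ℝ) + (d 4 : ℝ)) - ((d 0 : ℝ) + (d 5 : ℝ))) := Real.log_le_log (by linarith only [c0, c5, c6]) (by linarith only [c1, c9])
  have tN20 : Real.log (((d 1 : ℝ) + (d 4 : ℝ)) - ((d 2 : ℝ) + (d 2 : ℝ))) ≤ Real.log (((d 4 : ℝ) + (d 4 : ℝ)) - ((d 1 : ℝ) + (d 3 : ℝ))) := Real.log_le_log (by linarith only [c0, c5, c6]) (by linarith only [c1, c6])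
  have tS0 : Real.log 2 + (Real.log (((d 4 : ℝ)) - ((d 0 : ℝ))) + Real.log (((d 4 : ℝ)) - ((d 0 : ℝ)))) / 2 ≤ Real.log (((d 4 : ℝ) + (d 4 : ℝ)) - ((d 0 : ℝ) + (d 0 : ℝ))) := log_two_add_half_le (by linarith only [c0, c1, c6, c14, c19]) (by linarith only [c0, c1, c6, c14, c19]) (by linarith only [c0])
  have tS1 : Real.log 2 + (Real.log (((d 2 : ℝ) + (d 3 : ℝ)) - ((d 0 : ℝ) + (d 5 : ℝ))) + Real.log (((d 2 : ℝ)) - ((d 1 : ℝ)))) / 2 ≤ Real.log (((d 2 : ℝ) + (d 2 : ℝ)) - ((d 1 : ℝ) + (d 1 : ℝ))) := log_two_add_half_le (by linarith only [c9, c10]) (by linarith only [c1]) (by linarith only [c8])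
  have tS2 : Real.log 2 + (Real.log (((d 2 : ℝ) + (d 3 : ℝ)) - ((d 0 : ℝ) + (d 5 : ℝ))) + Real.log (((d 4 : ℝ) + (d 4 : ℝ)) - ((d 3 : ℝ) + (d 3 : ℝ)))) / 2 ≤ Real.log (((d 4 : ℝ) + (d 4 : ℝ)) - ((d 2 : ℝ) + (d 5 : ℝ))) := log_two_add_half_le (by linarith only [c9, c10]) (by linarith only [c6]) (by linarith only [c5])
  have tS3 : Real.log 2 + (Real.log (((d 1 : ℝ) + (d 4 : ℝ)) - ((d 0 : ℝ) + (d 2 : ℝ))) + Real.log (((d 5 : ℝ) + (d 5 : ℝ)) - ((d 1 : ℝ) + (d 4 : ℝ)))) / 2 ≤ Real.log (((d 5 : ℝ) + (d 5 : ℝ)) - ((d 0 : ℝ) + (d 2 : ℝ))) := log_two_add_half_le (by linarith only [c0, c6, c14, c19]) (by linarith only [c1, c6, c14, c19]) (by linarith only [c0])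
  have tS4 : Real.log 2 + (Real.log (((d 1 : ℝ) + (d 4 : ℝ)) - ((d 0 : ℝ) + (d 3 : ℝ))) + Real.log (((d 4 : ℝ) + (d 4 : ℝ)) - ((d 2 : ℝ) + (d 2 : ℝ)))) / 2 ≤ Real.log (((d 4 : ℝ) + (d 4 : ℝ)) - ((d 0 : ℝ) + (d 2 : ℝ))) := log_two_add_half_le (by linarith only [c0, c6]) (by linarith only [c6, c14, c19]) (by linarith only [c10])
  have tS5 : Real.log 2 + (Real.log (((d 1 : ℝ)) - ((d 0 : ℝ))) + Real.log (((d 1 : ℝ)) - ((d 0 : ℝ)))) / 2 ≤ Real.log (((d 1 : ℝ) + (d 1 : ℝ)) - ((d 0 : ℝ) + (d 0 : ℝ))) := log_two_add_half_le (by linarith only [c0]) (by linarith only [c0]) (by linarith only [c0])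
  have tS6 : Real.log 2 + (Real.log (((d 1 : ℝ) + (d 4 : ℝ)) - ((d 0 : ℝ) + (d 5 : ℝ))) + Real.log (((d 1 : ℝ) + (d 4 : ℝ)) - ((d 0 : ℝ) + (d 5 : ℝ)))) / 2 ≤ Real.log (((d 4 : ℝ) + (d 4 : ℝ)) - ((d 3 : ℝ) + (d 3 : ℝ))) := log_two_add_half_le (by linarith only [c9]) (by linarith only [c9]) (by linarith only [c8])
  have tS7 : Real.log 2 + (Real.log (((d 1 : ℝ) + (d 4 : ℝ)) - ((d 0 : ℝ) + (d 5 : ℝ))) + Real.log (((d 2 : ℝ) + (d 3 : ℝ)) - ((d 1 : ℝ) + (d 4 : ℝ)))) / 2 ≤ Real.log (((d 2 : ℝ) + (d 3 : ℝ)) - ((d 0 : ℝ) + (d 5 : ℝ))) := log_two_add_half_le (by linarith only [c9]) (by linarith only [c10]) (by linarith only [c0])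
  have tS8 : Real.log 2 + (Real.log (((d 2 : ℝ) + (d 4 : ℝ)) - ((d 1 : ℝ) + (d 1 : ℝ))) + Real.log (((d 2 : ℝ) + (d 5 : ℝ)) - ((d 1 : ℝ) + (d 4 : ℝ)))) / 2 ≤ Real.log (((d 3 : ℝ) + (d 4 : ℝ)) - ((d 1 : ℝ) + (d 1 : ℝ))) := log_two_add_half_le (by linarith only [c1, c6, c14, c19]) (by linarith only [c1, c19]) (by linarith only [c5, c9])
  have tS9 : Real.log 2 + (Real.log (((d 4 : ℝ) + (d 5 : ℝ)) - ((d 1 : ℝ) + (d 3 : ℝ))) + Real.log (((d 3 : ℝ) + (d 5 : ℝ)) - ((d 1 : ℝ) + (d 4 : ℝ)))) / 2 ≤ Real.log (((d 5 : ℝ) + (d 5 : ℝ)) - ((d 1 : ℝ) + (d 1 : ℝ))) := log_two_add_half_le (by linarith only [c1, c6, c14, c19]) (by linarith only [c1, c6, c14, c19]) (by linarith only [c0])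
  have tS10 : Real.log 2 + (Real.log (((d 4 : ℝ) + (d 4 : ℝ)) - ((d 1 : ℝ) + (d 3 : ℝ))) + Real.log (((d 1 : ℝ) + (d 4 : ℝ)) - ((d 2 : ℝ) + (d 2 : ℝ)))) / 2 ≤ Real.log (((d 4 : ℝ) + (d 4 : ℝ)) - ((d 1 : ℝ) + (d 2 : ℝ))) := log_two_add_half_le (by linarith only [c1, c6, c14, c19]) (by linarith only [c0, c5, c6]) (by linarith only [c10])
  have tS11 : Real.log 2 + (Real.log (((d 4 : ℝ)) - ((d 1 : ℝ))) + Real.log (((d 4 : ℝ)) - ((d 1 : ℝ)))) / 2 ≤ Real.log (((d 4 : ℝ) + (d 4 : ℝ)) - ((d 1 : ℝ) + (d 1 : ℝ))) := log_two_add_half_le (by linarith only [c1, c6, c14, c19]) (by linarith only [c1, c6, c14, c19]) (by linarith only [c0])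
  have tS12 : Real.log 2 + (Real.log (((d 3 : ℝ)) - ((d 1 : ℝ))) + Real.log (((d 3 : ℝ) + (d 3 : ℝ)) - ((d 1 : ℝ) + (d 4 : ℝ)))) / 2 ≤ Real.log (((d 3 : ℝ) + (d 3 : ℝ)) - ((d 1 : ℝ) + (d 1 : ℝ))) := log_two_add_half_le (by linarith only [c1, c6, c14, c19]) (by linarith only [c1, c14, c19]) (by linarith only [c6])
  have tS13 : Real.log 2 + (Real.log (((d 3 : ℝ)) - ((d 1 : ℝ))) + Real.log (((d 2 : ℝ) + (d 5 : ℝ)) - ((d 1 : ℝ) + (d 3 : ℝ)))) / 2 ≤ Real.log (((d 2 : ℝ) + (d 5 : ℝ)) - ((d 1 : ℝ) + (d 1 : ℝ))) := log_two_add_half_le (by linarith only [c1, c6, c14, c19]) (by linarith only [c1, c6, c19]) (by linarith only [c0])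
  have tS14 : Real.log 2 + (Real.log (((d 2 : ℝ) + (d 4 : ℝ)) - ((d 1 : ℝ) + (d 3 : ℝ))) + Real.log (((d 2 : ℝ)) - ((d 1 : ℝ)))) / 2 ≤ Real.log (((d 0 : ℝ) + (d 4 : ℝ)) - ((d 1 : ℝ) + (d 1 : ℝ))) := log_two_add_half_le (by linarith only [c1, c6]) (by linarith only [c1]) (by linarith only [c5])
  have tS15 : Real.log 2 + (Real.log (((d 2 : ℝ) + (d 4 : ℝ)) - ((d 1 : ℝ) + (d 3 : ℝ))) + Real.log (((d 2 : ℝ) + (d 3 : ℝ)) - ((d 1 : ℝ) + (d 4 : ℝ)))) / 2 ≤ Real.log (((d 2 : ℝ) + (d 2 : ℝ)) - ((d 1 : ℝ) + (d 1 : ℝ))) := log_two_add_half_le (by linarith only [c1, c6]) (by linarith only [c10]) (by linarith only [c0])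
  have tS16 : Real.log 2 + (Real.log (((d 2 : ℝ)) - ((d 1 : ℝ))) + Real.log (((d 4 : ℝ) + (d 4 : ℝ)) - ((d 2 : ℝ) + (d 5 : ℝ)))) / 2 ≤ Real.log (((d 4 : ℝ) + (d 4 : ℝ)) - ((d 1 : ℝ) + (d 5 : ℝ))) := log_two_add_half_le (by linarith only [c1]) (by linarith only [c6, c14]) (by linarith only [c0])
  have tS17 : Real.log 2 + (Real.log (((d 2 : ℝ) + (d 3 : ℝ)) - ((d 1 : ℝ) + (d 4 : ℝ))) + Real.log (((d 4 : ℝ) + (d 4 : ℝ)) - ((d 3 : ℝ) + (d 3 : ℝ)))) / 2 ≤ Real.log (((d 2 : ℝ) + (d 4 : ℝ)) - ((d 1 : ℝ) + (d 3 : ℝ))) := log_two_add_half_le (by linarith only [c10]) (by linarith only [c6]) (by linarith only [c0])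
  have tS18 : Real.log 2 + (Real.log (((d 2 : ℝ) + (d 3 : ℝ)) - ((d 1 : ℝ) + (d 4 : ℝ))) + Real.log (((d 4 : ℝ)) - ((d 3 : ℝ)))) / 2 ≤ Real.log (((d 2 : ℝ)) - ((d 1 : ℝ))) := log_two_add_half_le (by linarith only [c10]) (by linarith only [c6]) (by linarith only [c0])
  have tS19 : Real.log 2 + (Real.log (((d 2 : ℝ) + (d 3 : ℝ)) - ((d 1 : ℝ) + (d 4 : ℝ))) + Real.log (((d 0 : ℝ) + (d 4 : ℝ)) - ((d 1 : ℝ) + (d 2 : ℝ)))) / 2 ≤ Real.log (((d 0 : ℝ) + (d 3 : ℝ)) - ((d 1 : ℝ) + (d 1 : ℝ))) := log_two_add_half_le (by linarith only [c10]) (by linarith only [c6, c8, c14]) (by linarith only [c0])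
  have tS20 : Real.log 2 + (Real.log (((d 4 : ℝ)) - ((d 3 : ℝ))) + Real.log (((d 4 : ℝ)) - ((d 3 : ℝ)))) / 2 ≤ Real.log (((d 4 : ℝ) + (d 4 : ℝ)) - ((d 3 : ℝ) + (d 3 : ℝ))) := log_two_add_half_le (by linarith only [c6]) (by linarith only [c6]) (by linarith only [c0])
  have tS21 : Real.log 2 + (Real.log (((d 5 : ℝ)) - ((d 4 : ℝ))) + Real.log (((d 5 : ℝ)) - ((d 4 : ℝ)))) / 2 ≤ Real.log (((d 5 : ℝ) + (d 5 : ℝ)) - ((d 4 : ℝ) + (d 4 : ℝ))) := log_two_add_half_le (by linarith only [c19]) (by linarith only [c19]) (by linarith only [c0])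
  have tQ0 : Real.log (((d 5 : ℝ)) - ((d 1 : ℝ))) ≤ (1 : ℝ) * Real.log 2 + Real.log (((d 4 : ℝ) + (d 4 : ℝ)) - ((d 0 : ℝ) + (d 5 : ℝ))) := by
    simpa only [Nat.cast_ofNat, Nat.cast_one] using log_le_of_le_two_pow_mul (j := 1) (by linarith only [c1, c6, c14, c19]) (by linarith only [c0, c1, c6, c14]) (by linarith only [c1, c6, c9, c14])
  have tQ1 : Real.log (((d 5 : ℝ) + (d 5 : ℝ)) - ((d 0 : ℝ) + (d 2 : ℝ))) ≤ (2 : ℝ) * Real.log 2 + Real.log (((d 5 : ℝ) + (d 5 : ℝ)) - ((d 3 : ℝ) + (d 4 : ℝ))) := by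
    simpa only [Nat.cast_ofNat, Nat.cast_one] using log_le_of_le_two_pow_mul (j := 2) (by linarith only [c0, c1, c6, c14, c19]) (by linarith only [c6, c19]) (by linarith only [c8, _hq0, _hq3])
  have tQ2 : Real.log (((d 1 : ℝ) + (d 4 : ℝ)) - ((d 0 : ℝ) + (d 3 : ℝ))) ≤ (2 : ℝ) * Real.log 2 + Real.log (((d 1 : ℝ) + (d 1 : ℝ)) - ((d 0 : ℝ) + (d 2 : ℝ))) := by
    simpa only [Nat.cast_ofNat, Nat.cast_one] using log_le_of_le_two_pow_mul (j := 2) (by linarith only [c0, c6]) (by linarith only [c2]) (by linarith only [c9, _hq1, _hq2])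
  have tQ3 : Real.log (((d 5 : ℝ) + (d 5 : ℝ)) - ((d 3 : ℝ) + (d 4 : ℝ))) ≤ (3 : ℝ) * Real.log 2 + Real.log (((d 3 : ℝ) + (d 5 : ℝ)) - ((d 4 : ℝ) + (d 4 : ℝ))) := by
    simpa only [Nat.cast_ofNat, Nat.cast_one] using log_le_of_le_two_pow_mul (j := 3) (by linarith only [c6, c19]) (by linarith only [c17]) (by linarith only [c10, _hq1, _hq3])
  have hlog2 : 0 < Real.log 2 := Real.log_pos (by norm_num)
  linarith only [hlog2, tN0, tN1, tN2, tN3, tN4, tN5, tN6, tN7, tN8, tN9, tN10, tN11, tN12, tN13, tN14, tN15, tN16, tN17, tN18, tN19, tN20, tS0, tS1, tS2, tS3, tS4, tS5, tS6, tS7, tS8, tS9, tS10, tS11, tS12, tS13, tS14, tS15, tS16, tS17, tS18, tS19, tS20, tS21, tQ0, tQ1, tQ2, tQ3]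

end Summit.ValiantsHypothesis.ValiantsHypothesis.Theorems.LacunarySymmetroidMatrixDescartes.Census
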